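import Summits.RiemannHypothesis.RiemannHypothesis.Theses.NbSectionZeroLaw
import HarnessLib

/-!
# Route NbSectionZeroLaw (L36 «intrinsic zero law of the sections») — `Assembly`

Item stmt-RiemannHypothesis-23097: `IntrinsicDualBound → ZeroBasedClosure → SectionZeroLaw`, the ε-argument
in `ℝ≥0∞`: weak duality (`IntrinsicDualBound`) gives `sup ≤ inf`, the zero-based closure conjecture
(`ZeroBasedClosure`) gives ε-attainment hence `inf ≤ sup`. This is the planner's kernel-checked composition
(rh-idea-3 g0, `pub/ideators/rh-idea-3/own3/Sketch5.lean` sha16 85e3235f32d155cb, `iInf_eq_iSup_of_weak_duality` +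
`assembly_holds`, ll.86–112) written against the route decls; both hypotheses are consumed. Standard axioms.
The abstract lemma is pure order theory in `ℝ≥0∞`; no summit is proved by this; nothing here bears on the truth of RH.
-/

-- D-0017: `Summit.RiemannHypothesis.RiemannHypothesis.…` duplicates the namespace BY DESIGN (single-problem summit).
set_option linter.dupNamespace false

namespace Summit.RiemannHypothesis.RiemannHypothesis.Theorems.NbSectionZeroLawAssembly

/-- **Abstract strong duality in `ℝ≥0∞`**: weak duality (`hlow`: every certified dual value is below every
primal value) plus `ε`-attainment (`hup`: for every `ε > 0` some certified dual value comes within `ε` of some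
primal value) give `⨅ primal = ⨆ dual`. Pure; rh-idea-3 Sketch5 `iInf_eq_iSup_of_weak_duality` verbatim. -/
theorem iInf_eq_iSup_of_weak_duality
    (F : (N : ℕ) → (Fin N → ℂ) → ENNReal) (q : (k : ℕ) → (Fin k → ℂ) → (Fin k → ℂ) → ℝ)
    (P : (k : ℕ) → (Fin k → ℂ) → Prop)
    (hlow : ∀ (N : ℕ) (a : Fin N → ℂ) (k : ℕ) (ρ x : Fin k → ℂ), P k ρ →
      ENNReal.ofReal (q k ρ x) ≤ F N a)
    (hup : ∀ ε : ℝ, 0 < ε → ∃ (k : ℕ) (ρ x : Fin k → ℂ), P k ρ ∧ ∃ (N : ℕ) (a : Fin N → ℂ),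
      F N a ≤ ENNReal.ofReal (q k ρ x + ε)) :
    (⨅ (N : ℕ) (a : Fin N → ℂ), F N a) =
      ⨆ (k : ℕ) (ρ : Fin k → ℂ) (x : Fin k → ℂ) (_ : P k ρ), ENNReal.ofReal (q k ρ x) := by
  apply le_antisymm
  · refine ENNReal.le_of_forall_pos_le_add fun ε hε _ ↦ ?_
    obtain ⟨k, ρ, x, hρ, N, a, hle⟩ := hup ε (by exact_mod_cast hε)
    calc (⨅ (N : ℕ) (a : Fin N → ℂ), F N a) ≤ F N a := (iInf_le _ N).trans (iInf_le _ a)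
      _ ≤ ENNReal.ofReal (q k ρ x + ε) := hle
      _ ≤ ENNReal.ofReal (q k ρ x) + ENNReal.ofReal ε := ENNReal.ofReal_add_le
      _ ≤ _ := by
          rw [ENNReal.ofReal_coe_nnreal]
          gcongr
          exact le_iSup_of_le k <| le_iSup_of_le ρ <| le_iSup_of_le x <| le_iSup_of_le hρ le_rfl
  · refine iSup_le fun k ↦ iSup_le fun ρ ↦ iSup_le fun x ↦ iSup_le fun hρ ↦ ?_
    exact le_iInf fun N ↦ le_iInf fun a ↦ hlow N a k ρ x hρ

/-- **`Assembly` (item stmt-RiemannHypothesis-23097) holds**: for each `M ≥ 1` apply the abstract strong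
duality to the primal family `F N a = ∫ |1 − ζ_M A_a|² dt/(¼+t²)`, the dual values `q k ρ x = 2π|Σ conj(x_i)/ρ_i|²/Re Q`
and the certificate predicate `P k ρ = (∀ i, ζ_M(ρ_i) = 0 ∧ Re ρ_i > ½)`: `hlow` is `IntrinsicDualBound M`,
`hup` is `ZeroBasedClosure M`. (rh-idea-3 Sketch5 `assembly_holds`.) RH-free. -/
theorem assembly_proof :
    Summit.RiemannHypothesis.RiemannHypothesis.Theses.NbSectionZeroLaw.Assembly := by
  unfold Summit.RiemannHypothesis.RiemannHypothesis.Theses.NbSectionZeroLaw.Assembly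
  intro h3 h2 M hM
  exact iInf_eq_iSup_of_weak_duality _ _ _ (fun N a k ρ x hρ ↦ h3 M N a k ρ x hρ)
    (fun ε hε ↦ h2 M hM ε hε)

end Summit.RiemannHypothesis.RiemannHypothesis.Theorems.NbSectionZeroLawAssembly
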